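import Literature.Analysis.FluidPDE.NSFourierPlancherel
import Literature.MathematicalPhysics.QuantumManyBody.PeriodicBoseGas
import HarnessLib

/-!
# `∫|𝓕h|² ≤ ∫|h|²` for every measurable function on `ℝ³` (Plancherel as an inequality)

Topic `Literature/MathematicalPhysics/QuantumManyBody` (provefact
`Literature.MathematicalPhysics.QuantumManyBody.BoseGas.Fournais2020_condensation`, layer `Fournais2020_lemma24`).
The momentum-space bookkeeping of [Fournais2020, Lemma 2.4] ((2.29)–(2.32): `∫‖b_pΦ‖²dp`,
`∫|𝓕(χ_ΛQᵢΦ(X;·))(p)|²dp`) needs Plancherel for the slices `χ_Λ QᵢΦ(X; ·)` of an `L²` state,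
which are `L¹ ∩ L²` for a.e. `X` only. The convenient form is the unconditional inequality
`∫⁻ |𝓕h|² dp ≤ ∫⁻ |h|² dy` (`lintegral_enorm_sq_fourier_le`): equality for `h ∈ L¹ ∩ L²`
(the tree's Plancherel `Literature.Analysis.FluidPDE.FourierNS.eLpNorm_fourierIntegral_eq`, built on
Mathlib's `L²` Fourier isometry), `0 ≤ …` when `h ∉ L¹` (Mathlib's Fourier integral of a
non-integrable function is `0`), and `… ≤ ∞` when `h ∉ L²`.

## References

* [Fournais2020] S. Fournais, *Length scales for BEC in the dilute Bose gas*, arXiv:2011.00309,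
  EMS Ser. Congr. Rep. 18 (2021), doi:10.4171/ecr/18-1/7: Lemma 2.4, (2.29)–(2.32).
* E. M. Stein, G. Weiss, *Introduction to Fourier Analysis on Euclidean Spaces*, PUP 1971, Ch. I, Thm. 2.3.
-/

noncomputable section

open MeasureTheory Set
open scoped ENNReal NNReal FourierTransform

namespace Literature.MathematicalPhysics.QuantumManyBody.BoseGas

/-- The Fourier integral of a non-integrable function vanishes identically (Bochner convention).
[folklore] -/
theorem fourier_eq_zero_of_not_integrable {h : Space → ℂ} (hh : ¬Integrable h) : 𝓕 h = 0 := by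
  funext p
  rw [Real.fourier_eq, Pi.zero_apply]
  exact integral_undef fun hint => hh ((Real.fourierIntegral_convergent_iff p).1 hint)

/-- `eLpNorm f 2 = (∫⁻ ‖f‖ₑ²)^{1/2}`, with a natural-number power. [folklore] -/
theorem eLpNorm_two_eq_sq {α : Type*} [MeasurableSpace α] (μ : Measure α) (f : α → ℂ) :
    eLpNorm f 2 μ = (∫⁻ x, ‖f x‖ₑ ^ 2 ∂μ) ^ (1 / 2 : ℝ) := by
  rw [eLpNorm_eq_lintegral_rpow_enorm_toReal two_ne_zero ENNReal.ofNat_ne_top, ENNReal.toReal_ofNat]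
  congr 1
  refine lintegral_congr fun x => ?_
  rw [show (2 : ℝ) = ((2 : ℕ) : ℝ) by norm_num, ENNReal.rpow_natCast]

/-- **`∫|𝓕h|² ≤ ∫|h|²` for every function on `ℝ³`** (Plancherel as an unconditional inequality
in `ℝ≥0∞`). [folklore] -/
theorem lintegral_enorm_sq_fourier_le (h : Space → ℂ) (hm : AEStronglyMeasurable h volume) :
    ∫⁻ p, ‖𝓕 h p‖ₑ ^ 2 ≤ ∫⁻ y, ‖h y‖ₑ ^ 2 := by
  by_cases hint : Integrable h
  · by_cases h2 : MemLp h 2 volume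
    · -- Plancherel
      have hP := Literature.Analysis.FluidPDE.FourierNS.eLpNorm_fourierIntegral_eq hint h2
      rw [eLpNorm_two_eq_sq, eLpNorm_two_eq_sq] at hP
      have := congrArg (fun t : ℝ≥0∞ => t ^ (2 : ℝ)) hP
      simp only [one_div, ENNReal.rpow_inv_rpow (two_ne_zero' ℝ)] at this
      exact this.le
    · -- `h ∉ L²`: the right-hand side is infinite
      have htop : ∫⁻ y, ‖h y‖ₑ ^ 2 = ⊤ := by
        by_contra hne
        refine h2 ⟨hm, ?_⟩
        rw [eLpNorm_two_eq_sq]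
        exact ENNReal.rpow_lt_top_of_nonneg (by norm_num) hne
      rw [htop]
      exact le_top
  · rw [fourier_eq_zero_of_not_integrable hint]
    simp

/-- The same with `‖·‖₊`-squares. [folklore] -/
theorem lintegral_nnnorm_sq_fourier_le (h : Space → ℂ) (hm : AEStronglyMeasurable h volume) :
    ∫⁻ p, ((‖𝓕 h p‖₊ : ℝ≥0∞)) ^ 2 ≤ ∫⁻ y, ((‖h y‖₊ : ℝ≥0∞)) ^ 2 :=
  lintegral_enorm_sq_fourier_le h hm

end Literature.MathematicalPhysics.QuantumManyBody.BoseGas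

end
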